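import Literature.Topology.FourManifolds.CappellShanesonTwentysevenIdealClasses
import Literature.Topology.FourManifolds.CappellShanesonClassGroupTwelve
import HarnessLib

/-!
# Kim–Yamada's Theorem B for the traces `27` and `-22`: the non-maximal order `ℤ[Θ₂₇]`

Serves the named fact
`Literature.Topology.FourManifolds.kimYamada2023_nonempty_diffeomorph_sphere_four_of_trace_mem_Icc`
(`CappellShaneson.lean`; M. H. Kim, S. Yamada, *Ideal classes and Cappell–Shaneson homotopy
4-spheres*, Kyungpook Math. J. 63 (2023) 373–411 = arXiv:1707.03860, Cor. C), reduced in the tree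
to Gompf's topological leaves and Theorem B in matrix form (`GompfConjectureForTrace n`: every
`A ∈ SL(3, ℤ)` with `det (A - 1) = 1` and `tr A = n` is Gompf equivalent to the Akbulut–Kirby
matrix `A₀`) for the traces of the window `[13, 69]` (the child `KimYamada2023_thmB_traces_13_69`
of `CappellShanesonStandardOfTraceRange.lean`).  The sibling files
`CappellShanesonClassGroup<N>Main.lean` treat the traces whose order `ℤ[Θₙ]` is the maximal order
through the class group of `𝓞 K`; the trace `27` is the one trace of the window where this fails
(Kim–Yamada, Prop. 4.11: `ℤ[Θ₂₇]` has index `7` in `𝓞 K = ℤ[ω]`; §4.3: "Among `3 ≤ n ≤ 75`,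
`n = 27` is the only case that `C(ℤ[Θₙ])` is not a group, but a monoid").  Its ideal class monoid
was determined in `CappellShanesonTwentysevenIdealClasses.lean` (Thm. 4.17, covering form:
`ideal_class_adjoinRoot_twentyseven`); this file runs Theorem B on it:

* `isConj_standardCSMatrix_of_trace_eq_twentyseven` — every Cappell–Shaneson matrix of trace `27`
  is similar to one of `X_{1,1,27}`, `X_{2,7,27}`, `X_{7,17,27}`, `X_{4,5,27}`, `X_{11,13,27}`,
  `X_{10,11,27}`, `X_{14,19,27}` (Prop. 2.14 / Latimer–MacDuffee–Taussky, via
  `exists_isConj_standardCSMatrix_of_cover`);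
* `gompfConjectureForTrace_twentyseven` — **Theorem B for `n = 27`**: each representative
  `(c, d, 27)` moves by Gompf's trace move `X_{c,d,n} ∼ X_{c,d,n+kd}` (Lemma 6.1) to the trace
  `27 mod d ∈ {6, 10, 2, 1, 5, 8} ⊆ [-7, 12]`, where the tree proves Gompf's conjecture outright
  (`gompfConjectureForTrace_of_mem_Icc_neg_seven_twelve`), and `X_{1,1,27} = A₂₅ ∼ A₀`; this is
  the printed induction of §6.1 ("By Lemma 6.1 … `(c,d,n) ∼ (c,d,n₀)` with `6 - n ≤ n₀ < n`");
* `gompfConjectureForTrace_neg_twentytwo` — Theorem B for `5 - 27 = -22` by Theorem A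
  (`gompfConjectureForTrace_of_five_sub`).

(The printed chain of §6.1 for the exceptional representative `(15, 109, 57)`, which ends at the
trace `27` — `gompfEquiv_akbulutKirbyMatrix_15_109_57` of `CappellShanesonGompfChains.lean`,
conditional on `GompfConjectureForTrace 27` — can now be fed `gompfConjectureForTrace_twentyseven`;
the tree already settles that representative unconditionally through the trace `8`,
`gompfEquiv_akbulutKirbyMatrix_15_109_57_eight` of `CappellShanesonGompfChainsExtra.lean`.)
Theorems only; no named fact is introduced.
-/

noncomputable section

open Set Polynomial
open scoped MatrixGroups

namespace Literature.Topology.FourManifolds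

/-! ### The seven representatives `(c, d, 27) ∈ 𝒞𝒮` -/

/-- `7 ∣ f₂₇(2) = -49`. [cite: KimYamada2023, Thm. 4.17] -/
theorem seven_dvd_eval_csPoly_twentyseven_two : (7 : ℤ) ∣ (csPoly 27).eval 2 := by
  norm_num [eval_csPoly]

/-- `17 ∣ f₂₇(7) = -799`. [cite: KimYamada2023, Thm. 4.17] -/
theorem seventeen_dvd_eval_csPoly_twentyseven_seven : (17 : ℤ) ∣ (csPoly 27).eval 7 := by
  norm_num [eval_csPoly]

/-- `5 ∣ f₂₇(4) = -265`. [cite: KimYamada2023, Thm. 4.17] -/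
theorem five_dvd_eval_csPoly_twentyseven_four : (5 : ℤ) ∣ (csPoly 27).eval 4 := by
  norm_num [eval_csPoly]

/-- `13 ∣ f₂₇(11) = -1651`. [cite: KimYamada2023, Thm. 4.17] -/
theorem thirteen_dvd_eval_csPoly_twentyseven_eleven : (13 : ℤ) ∣ (csPoly 27).eval 11 := by
  norm_num [eval_csPoly]

/-- `11 ∣ f₂₇(10) = -1441`. [cite: KimYamada2023, Thm. 4.17] -/
theorem eleven_dvd_eval_csPoly_twentyseven_ten : (11 : ℤ) ∣ (csPoly 27).eval 10 := by
  norm_num [eval_csPoly]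

/-- `19 ∣ f₂₇(14) = -2185`. [cite: KimYamada2023, Thm. 4.17] -/
theorem nineteen_dvd_eval_csPoly_twentyseven_fourteen : (19 : ℤ) ∣ (csPoly 27).eval 14 := by
  norm_num [eval_csPoly]

/-! ### Theorem B for the traces `27` and `-22` -/

/-- **Every Cappell–Shaneson matrix of trace `27` is similar to one of the seven standard matrices
`X_{1,1,27} = A₂₅`, `X_{2,7,27}`, `X_{7,17,27}`, `X_{4,5,27}`, `X_{11,13,27}`, `X_{10,11,27}`,
`X_{14,19,27}`** (Prop. 2.14 on the ideal class monoid `C(ℤ[Θ₂₇])` of Thm. 4.17; the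
representatives `(1,1,27), (4,5,27), (10,11,27), (11,13,27), (7,17,27), (14,19,27)` of
`Pic(ℤ[Θ₂₇])` of §5.3 and the non-invertible class `(2,7,27)`). [cite: KimYamada2023, Thm. 4.17, §5.3 and Prop. 2.14] -/
theorem isConj_standardCSMatrix_of_trace_eq_twentyseven (A : SL(3, ℤ))
    (hdet : ((A : Matrix (Fin 3) (Fin 3) ℤ) - 1).det = 1)
    (htr : Matrix.trace (A : Matrix (Fin 3) (Fin 3) ℤ) = 27) :
    IsConj A (standardCSMatrix 1 1 27 (one_dvd _)) ∨
      IsConj A (standardCSMatrix 2 7 27 seven_dvd_eval_csPoly_twentyseven_two) ∨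
      IsConj A (standardCSMatrix 7 17 27 seventeen_dvd_eval_csPoly_twentyseven_seven) ∨
      IsConj A (standardCSMatrix 4 5 27 five_dvd_eval_csPoly_twentyseven_four) ∨
      IsConj A (standardCSMatrix 11 13 27 thirteen_dvd_eval_csPoly_twentyseven_eleven) ∨
      IsConj A (standardCSMatrix 10 11 27 eleven_dvd_eval_csPoly_twentyseven_ten) ∨
      IsConj A (standardCSMatrix 14 19 27 nineteen_dvd_eval_csPoly_twentyseven_fourteen) := by
  have hcover : ∀ J : Ideal (AdjoinRoot (csPoly 27)), J ≠ ⊥ →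
      ∃ (c d : ℤ) (_ : d ∣ (csPoly 27).eval c) (x y : AdjoinRoot (csPoly 27)),
        x ≠ 0 ∧ y ≠ 0 ∧ Ideal.span {x} * J = Ideal.span {y} * csIdeal c d 27 ∧
          ((c = 1 ∧ d = 1) ∨ (c = 2 ∧ d = 7) ∨ (c = 7 ∧ d = 17) ∨ (c = 4 ∧ d = 5) ∨
            (c = 11 ∧ d = 13) ∨ (c = 10 ∧ d = 11) ∨ (c = 14 ∧ d = 19)) := by
    intro J hJ
    obtain ⟨x, y, hx, hy, hxy⟩ := ideal_class_adjoinRoot_twentyseven J hJ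
    rcases hxy with h | h | h | h | h | h | h
    · exact ⟨1, 1, one_dvd _, x, y, hx, hy, h, Or.inl ⟨rfl, rfl⟩⟩
    · exact ⟨2, 7, seven_dvd_eval_csPoly_twentyseven_two, x, y, hx, hy, h,
        Or.inr (Or.inl ⟨rfl, rfl⟩)⟩
    · exact ⟨7, 17, seventeen_dvd_eval_csPoly_twentyseven_seven, x, y, hx, hy, h,
        Or.inr (Or.inr (Or.inl ⟨rfl, rfl⟩))⟩
    · exact ⟨4, 5, five_dvd_eval_csPoly_twentyseven_four, x, y, hx, hy, h,
        Or.inr (Or.inr (Or.inr (Or.inl ⟨rfl, rfl⟩)))⟩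
    · exact ⟨11, 13, thirteen_dvd_eval_csPoly_twentyseven_eleven, x, y, hx, hy, h,
        Or.inr (Or.inr (Or.inr (Or.inr (Or.inl ⟨rfl, rfl⟩))))⟩
    · exact ⟨10, 11, eleven_dvd_eval_csPoly_twentyseven_ten, x, y, hx, hy, h,
        Or.inr (Or.inr (Or.inr (Or.inr (Or.inr (Or.inl ⟨rfl, rfl⟩)))))⟩
    · exact ⟨14, 19, nineteen_dvd_eval_csPoly_twentyseven_fourteen, x, y, hx, hy, h,
        Or.inr (Or.inr (Or.inr (Or.inr (Or.inr (Or.inr ⟨rfl, rfl⟩)))))⟩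
  obtain ⟨c, d, h, hconj, hcd⟩ := exists_isConj_standardCSMatrix_of_cover _ hcover A hdet htr
  rcases hcd with ⟨rfl, rfl⟩ | ⟨rfl, rfl⟩ | ⟨rfl, rfl⟩ | ⟨rfl, rfl⟩ | ⟨rfl, rfl⟩ |
    ⟨rfl, rfl⟩ | ⟨rfl, rfl⟩
  · exact Or.inl hconj
  · exact Or.inr (Or.inl hconj)
  · exact Or.inr (Or.inr (Or.inl hconj))
  · exact Or.inr (Or.inr (Or.inr (Or.inl hconj)))
  · exact Or.inr (Or.inr (Or.inr (Or.inr (Or.inl hconj))))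
  · exact Or.inr (Or.inr (Or.inr (Or.inr (Or.inr (Or.inl hconj)))))
  · exact Or.inr (Or.inr (Or.inr (Or.inr (Or.inr (Or.inr hconj)))))

/-- **Kim–Yamada 2023, Theorem B for the trace `27`, PROVED** — the one trace of `[13, 69]` with
a non-Dedekind order `ℤ[Θₙ]`: the six non-trivial classes `(c, d, 27)` move by Gompf's trace move
(Lemma 6.1: `(c,d,n) ∼ (c,d,n₀)`, `n₀ ≡ n (mod d)`) to the traces `27 mod d = 6, 10, 2, 1, 5, 8`,
all inside the window `[-7, 12]` where Gompf's conjecture is a theorem of the tree, and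
`X_{1,1,27} = A₂₅ ∼ A₀`. [cite: KimYamada2023, Thm. B and §6.1 (proof, with Lemma 6.1 and Thm. 4.17)] -/
theorem gompfConjectureForTrace_twentyseven : GompfConjectureForTrace 27 := by
  intro A hdet htr
  have hW : ∀ m : ℤ, m ∈ Icc (-7 : ℤ) 12 → GompfConjectureForTrace m := fun m hm =>
    gompfConjectureForTrace_of_mem_Icc_neg_seven_twelve hm
  rcases isConj_standardCSMatrix_of_trace_eq_twentyseven A hdet htr with h | h | h | h | h | h | h
  · exact (GompfEquiv.of_isConj h).trans (gompfEquiv_standardCSMatrix_one_one 25 (one_dvd _))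
  · exact (GompfEquiv.of_isConj h).trans
      (gompfEquiv_standardCSMatrix_akbulutKirbyMatrix_of_modEq (hW 6 (by norm_num))
        seven_dvd_eval_csPoly_twentyseven_two (show (27 : ℤ) ≡ 6 [ZMOD 7] by decide))
  · exact (GompfEquiv.of_isConj h).trans
      (gompfEquiv_standardCSMatrix_akbulutKirbyMatrix_of_modEq (hW 10 (by norm_num))
        seventeen_dvd_eval_csPoly_twentyseven_seven (show (27 : ℤ) ≡ 10 [ZMOD 17] by decide))
  · exact (GompfEquiv.of_isConj h).trans
      (gompfEquiv_standardCSMatrix_akbulutKirbyMatrix_of_modEq (hW 2 (by norm_num))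
        five_dvd_eval_csPoly_twentyseven_four (show (27 : ℤ) ≡ 2 [ZMOD 5] by decide))
  · exact (GompfEquiv.of_isConj h).trans
      (gompfEquiv_standardCSMatrix_akbulutKirbyMatrix_of_modEq (hW 1 (by norm_num))
        thirteen_dvd_eval_csPoly_twentyseven_eleven (show (27 : ℤ) ≡ 1 [ZMOD 13] by decide))
  · exact (GompfEquiv.of_isConj h).trans
      (gompfEquiv_standardCSMatrix_akbulutKirbyMatrix_of_modEq (hW 5 (by norm_num))
        eleven_dvd_eval_csPoly_twentyseven_ten (show (27 : ℤ) ≡ 5 [ZMOD 11] by decide))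
  · exact (GompfEquiv.of_isConj h).trans
      (gompfEquiv_standardCSMatrix_akbulutKirbyMatrix_of_modEq (hW 8 (by norm_num))
        nineteen_dvd_eval_csPoly_twentyseven_fourteen (show (27 : ℤ) ≡ 8 [ZMOD 19] by decide))

/-- **Theorem B for the trace `-22`** (`= 5 - 27`), by Theorem A. [cite: KimYamada2023, Thm. A and Thm. B] -/
theorem gompfConjectureForTrace_neg_twentytwo : GompfConjectureForTrace (-22) := by
  have h := gompfConjectureForTrace_of_five_sub gompfConjectureForTrace_twentyseven
  norm_num at h
  exact h

end Literature.Topology.FourManifolds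

end
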